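import Summits.QuantumFields.BalabanUV.Beta.SpineRootedStepN

/-!
# The value-function third jet over a GENERIC resolvent kernel (`e3OfK`) — the re-typing socket for hR leaf (L3)

The rooted native spine's third jet (`SpineRooted.e3NAtOf`, gen 13) is
`e3NAtOf ρ j κ′ u′ = −mmRead (Lc^j) (KInv ∘ vertexOf (ScNAt ρ (j−1)) κ′ u′ ∘ KInv)` with the STRAIGHT packed resolvent
`KInv (N := Lc^j)` both in the `mm`-read sandwich and (through `vertexOf = vertexOfK KInv`) in the chain-rule vertex weights.
Lineage an3 (gen 29: `VertexReflectionContact`, `E3LevelOneReflection`, exact toy `E3LAW-J1-RESULT.md`) showed that the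
reflection-law socket (L3) of the `hR` root is NOT fillable at level 1 for this straight resolvent against the ROOTED stencils,
while it holds — with a diagonal contact — once the resolvent is consistently rooted∕dressed in BOTH places (row-owner decision
(L3-D), GAP C-an2-75).  This file provides the resolvent-GENERIC third jet
`e3OfK N K S κ′ u′ := −mmRead N (K ∘ vertexOfK K N S κ′ u′ ∘ K)` — any blocking `N`, any kernel `K`, any stencil family `S` —
proves that today's `e3NAtOf` is its instance at `K := KInv (N := Lc^j)`, `S := ScNAt ρ (j−1)` (`e3NAtOf_eq_e3OfK`, by
`OneStepKernelFamily.vertexOfK_KInv`), and proves the two structural facts every instance needs: locality (`locStencil_e3OfK`, from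
decay of `K` and locality of `S`) and block-translation covariance (`e3OfK_translate`, from `N`-translation invariance of `K` and (St)
of `S`).  The dressed instances (which `K`, which root at level `j`) are the subject of the re-typing and are NOT fixed here.

All declarations [folklore]; axioms standard.  Provenance: b2b-balaban β sub-cell, unit beta-an2 gen 15, 2026-08-20; no existing
file touched.  HONEST FRAMING: bookkeeping for the re-typing of one socket of one binder of row D1; NOT D1, NOT BetaPertH, NOT the
continuum limit, NOT Clay.
-/

open Finset
open scoped BigOperators
open Literature.MathematicalPhysics.QuantumFieldTheory
open Literature.MathematicalPhysics.QuantumFieldTheory.Balaban1983to89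
open Literature.MathematicalPhysics.QuantumFieldTheory.Balaban1983to89.Beta
open ExpKernelCalculus (MKer Decays BiLoc comp shiftK Zl)
open OneStepResolventKernel (Fib LocStencil KInv decays_mono biLoc_mono)
open OneStepKernelFamily (vertexOfK vertexOfK_KInv vertexFamily_vertexOfK')
open AffineAveraging (box toSite)
open BalabanStepJetsSucc (mmRead vertexOfK_translate_block comp_sandwich_shiftK mmRead_shiftK_smul biLoc_comp_right biLoc_mmRead)

noncomputable section

namespace Summit.QuantumFields.BalabanUV.Beta.SpineRooted

variable {d : ℕ}

/-! ## §1 Definition and the straight instance -/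

/-- [folklore] **THE VALUE-FUNCTION THIRD JET OVER A GENERIC RESOLVENT**: for a blocking `N`, a kernel `K` (the resolvent used BOTH as
the sandwich and as the source of the chain-rule vertex weights) and a first-order stencil family `S` on the fine lattice indexed by the
coarse bonds, `e3OfK N K S κ′ u′ := −mmRead N (K ∘ vertexOfK K N S κ′ u′ ∘ K)`. -/
def e3OfK (N : ℕ) (K : MKer (d + 1) (Fib d)) (S : Fin (d + 1) → (Fin (d + 1) → ℤ) → MKer (d + 1) (Fib d)) :
    Fin (d + 1) → (Fin (d + 1) → ℤ) → MKer (d + 1) (Fib d) :=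
  fun κ' u' x' z' a b => -(mmRead N (comp (comp K (vertexOfK K N S κ' u')) K) x' z' a b)

/-- [folklore] Unfolding lemma. -/
theorem e3OfK_apply (N : ℕ) (K : MKer (d + 1) (Fib d)) (S : Fin (d + 1) → (Fin (d + 1) → ℤ) → MKer (d + 1) (Fib d))
    (κ' : Fin (d + 1)) (u' x' z' : Fin (d + 1) → ℤ) (a b : Fib d) :
    e3OfK N K S κ' u' x' z' a b = -(mmRead N (comp (comp K (vertexOfK K N S κ' u')) K) x' z' a b) := rfl

/-- [folklore] **TODAY'S THIRD JET IS THE STRAIGHT INSTANCE**: `e3NAtOf ρ j = e3OfK (Lc^j) (KInv (N := Lc^j)) (ScNAt ρ (j−1))`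
(`vertexOf = vertexOfK KInv`, `OneStepKernelFamily.vertexOfK_KInv`). -/
theorem e3NAtOf_eq_e3OfK {Lc : ℕ} [NeZero Lc] (ρ : Fin (d + 1) → ℤ) (cE cVH cΛ : ℝ) (j : ℕ) :
    e3NAtOf d Lc ρ cE cVH cΛ j = e3OfK (Lc ^ j) (KInv (N := Lc ^ j) (d := d)) (ScNAt d Lc ρ cE cVH cΛ (j - 1)) := by
  funext κ' u' x' z' a b
  rw [e3OfK_apply, vertexOfK_KInv]
  rfl

/-! ## §2 Locality -/

/-- [folklore] **`e3OfK N K S` IS A LOCAL STENCIL FAMILY** on the coarse lattice whenever `K` decays and `S` is a local stencil family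
(`1 ≤ N`).  (Proof of `locStencil_e3NAtOf` with `decays_KInv`, `vertexFamily_vertexOf'` replaced by the hypotheses.) -/
theorem locStencil_e3OfK {N : ℕ} (hN : 1 ≤ N) {K : MKer (d + 1) (Fib d)} (hK : ∃ δ C : ℝ, 0 < δ ∧ 0 ≤ C ∧ Decays K C δ)
    {S : Fin (d + 1) → (Fin (d + 1) → ℤ) → MKer (d + 1) (Fib d)} {Cs δs : ℝ} (hS : LocStencil S Cs δs) (hδs : 0 < δs) :
    ∃ C δ : ℝ, 0 < δ ∧ LocStencil (e3OfK N K S) C δ := by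
  obtain ⟨δK, CK, hδK, hCK, hKd⟩ := hK
  obtain ⟨Cv, δv, hδv, hV⟩ := vertexFamily_vertexOfK' (N := N) ⟨δK, CK, hδK, hCK, hKd⟩ hS hδs
  set m : ℝ := min δK δv with hm
  have hm0 : 0 < m := lt_min hδK hδv
  have hCv : 0 ≤ Cv := (hV 0 0).nonneg (Sum.inl 0)
  have hKm : Decays K CK m := decays_mono hKd hCK le_rfl (min_le_left _ _)
  have hKm2 : Decays K CK (m / 2) := decays_mono hKd hCK le_rfl (by linarith [min_le_left δK δv])
  refine ⟨(Fintype.card (Fib d) : ℝ) * (((Fintype.card (Fib d) : ℝ) * (CK * Cv) * Zl (d + 1) (m - m / 2)) * CK) *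
      Zl (d + 1) (m / 2 - m / 4), m / 4, by positivity, fun κ' u' => ?_⟩
  have hVm : BiLoc (vertexOfK K N S κ' u') (((N : ℕ) : ℤ) • u') (((N : ℕ) : ℤ) • u') Cv m :=
    biLoc_mono (hV κ' u') hCv (min_le_right _ _)
  have h1 := ExpKernelCalculus.biLoc_comp_decays hKm hVm (show 0 ≤ m / 2 by positivity) (by linarith)
  have h2 := biLoc_comp_right h1 hKm2 (show 0 ≤ m / 4 by positivity) (by linarith)
  intro x' z' a b
  rw [e3OfK_apply, abs_neg]
  exact biLoc_mmRead hN h2 (by positivity) x' z' a b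

/-! ## §3 Block-translation covariance -/

/-- [folklore] **`e3OfK N K S` IS TRANSLATION COVARIANT ON THE COARSE LATTICE** whenever `K` is invariant under the `N`-translations
and `S` satisfies (St) at blocking `N`. -/
theorem e3OfK_translate {N : ℕ} {K : MKer (d + 1) (Fib d)} (hKs : ∀ t : Fin (d + 1) → ℤ, shiftK (-((N : ℤ) • t)) K = K)
    {S : Fin (d + 1) → (Fin (d + 1) → ℤ) → MKer (d + 1) (Fib d)}
    (hS : ∀ (κ : Fin (d + 1)) (u t : Fin (d + 1) → ℤ), S κ (u + (N : ℤ) • t) = shiftK (-((N : ℤ) • t)) (S κ u))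
    (κ' : Fin (d + 1)) (u' t' : Fin (d + 1) → ℤ) :
    e3OfK N K S κ' (u' + t') = shiftK (-t') (e3OfK N K S κ' u') := by
  have hV := vertexOfK_translate_block (N := N) hKs hS κ' u' t'
  funext x' z' a b
  simp only [e3OfK_apply, shiftK]
  rw [hV, comp_sandwich_shiftK (hKs t'), mmRead_shiftK_smul]
  rfl

end Summit.QuantumFields.BalabanUV.Beta.SpineRooted

end
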